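import Summits.QuantumFields.YangMills.Theorems.FlatTubeReductionGaussianLayerCake
import HarnessLib

/-!
# The WEIGHTED moment ratio: densities `ρ = F·σ` with a bounded profile/Faddeev–Popov weight `F ≥ 0` and a kernel ratio `0 ≤ σ ≤ C₁e^{−N}`, `σ ≥ c₁` on a floor set
# (tool for the log-free MOMENT analysis of the rate twin «ratepack-v3 / frozen fibres»; route `FlatTubeReduction`, crux K1 `NearFlatRatioLaw` stmt-QuantumFields-24720;
# seat `ym-line-ftr-p1` g12; R2b1 RECORD rung — no summit statement is proved here)

WHY (memo `Cruxes/NearFlatRatioLaw/Lines/ratepack-v3-frozen-g12.md` §5.7, brick (viii)).  The reference density of the (T)-diagonal is a PRODUCT `ρ₁(p) = F(p)·σ(p)` with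
`F = Ω(v̂)W(g)Ω(v̂′)` (profile × FP window, bounded, NOT Gaussian in the level `N = β·kinDefect`) and `σ = K_β(oT 1 v, (oT 1 v′)^g)/K₁(1,1) ≤ e^{−N}`
(`…ReferenceDensityDomination.fpTriple_one_one_div_le`), `σ ≥ c₁` on the core box (`fpTriple_one_one_div_ge`).  The volume growth and the floor are then those of the
`F`-WEIGHTED measure — `∫_{N≤t}F ≤ V(t+1)^m` (kinetic level sets × profile moments) and `∫_A F ≥ v` — which is `…GaussianLayerCake.moment_ratio_le_of_volume_growth_floorSet`
applied to `μ.withDensity F`: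
  ★★ `moment_ratio_le_weighted` — `∫FσM dμ ≤ (5e·2^k·4^m·k!·m!·C₁·D·V/(c₁v))·∫Fσ dμ`;
  ★ `setIntegral_weighted_tail_le` (appended) — `∫_{T<N} Fσ dμ ≤ C₁e^{−T/2}·5e^{1/2}4^m m!·V`.
HONEST FRAMING: elementary measure theory (Mathlib only); femto rung R2b1 (RECORD label); not infinite volume, not a gap, not Clay.  No defs, no named facts, no `sorry`.
-/

set_option autoImplicit false

noncomputable section

open MeasureTheory Filter Topology Real
open scoped BigOperators ENNReal

namespace Summit.QuantumFields.YangMills.Theorems.FemtoTransferGap.RateTube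

variable {X : Type*} [MeasurableSpace X]

/-- Integration against `μ.withDensity F` is integration of `F·g` against `μ` (`F ≥ 0` real measurable). [folklore] -/
theorem integral_withDensity_ofReal_eq (μ : Measure X) {F : X → ℝ} (hFm : Measurable F) (hF0 : ∀ x, 0 ≤ F x) (g : X → ℝ) :
    ∫ x, g x ∂μ.withDensity (fun x => ENNReal.ofReal (F x)) = ∫ x, F x * g x ∂μ := by
  rw [integral_withDensity_eq_integral_toReal_smul (Measurable.ennreal_ofReal hFm) (ae_of_all _ fun x => ENNReal.ofReal_lt_top)]
  refine integral_congr_ae (ae_of_all _ fun x => ?_)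
  dsimp only
  rw [ENNReal.toReal_ofReal (hF0 x), smul_eq_mul]

/-- The `withDensity F` mass of a measurable set is `∫_S F dμ` (`F ≥ 0` integrable). [folklore] -/
theorem withDensity_ofReal_real_apply (μ : Measure X) {F : X → ℝ} (hFi : Integrable F μ) (hF0 : ∀ x, 0 ≤ F x) {S : Set X} (hS : MeasurableSet S) :
    (μ.withDensity (fun x => ENNReal.ofReal (F x))).real S = ∫ x in S, F x ∂μ := by
  rw [measureReal_def, withDensity_apply _ hS, ← ofReal_integral_eq_lintegral_ofReal hFi.integrableOn (ae_of_all _ fun x => hF0 x),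
    ENNReal.toReal_ofReal (setIntegral_nonneg hS fun x _ => hF0 x)]

/-- ★★ **WEIGHTED MOMENT RATIO.**  `μ` finite; a bounded measurable weight `0 ≤ F ≤ C_F`; a measurable level `N ≥ 0` with `F`-weighted volume growth `∫_{N ≤ t}F dμ ≤ V(t+1)^m`
and a measurable floor set `A` with `∫_A F dμ ≥ v > 0`; a measurable kernel ratio `0 ≤ σ ≤ C₁e^{−N}` with `σ ≥ c₁ > 0` on `A`; a measurable weight `0 ≤ M ≤ D(N+1)^k`.  Then
`∫ FσM dμ ≤ (5e·2^k·4^m·k!·m!·C₁·D·V/(c₁v))·∫ Fσ dμ`. [folklore] -/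
theorem moment_ratio_le_weighted (μ : Measure X) [IsFiniteMeasure μ] {F : X → ℝ} (hFm : Measurable F) (hF0 : ∀ x, 0 ≤ F x) {CF : ℝ} (hFb : ∀ x, F x ≤ CF)
    {N : X → ℝ} (hNm : Measurable N) (hN0 : ∀ x, 0 ≤ N x) {V : ℝ} {m : ℕ} (hV : ∀ t : ℝ, 0 ≤ t → ∫ x in {x | N x ≤ t}, F x ∂μ ≤ V * (t + 1) ^ m)
    {A : Set X} (hA : MeasurableSet A) {v : ℝ} (hv0 : 0 < v) (hv : v ≤ ∫ x in A, F x ∂μ)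
    {σ M : X → ℝ} (hσm : Measurable σ) (hMm : Measurable M) (hσ0 : ∀ x, 0 ≤ σ x) {C₁ c₁ D : ℝ} (hC₁ : 0 ≤ C₁) (hc₁ : 0 < c₁) (hD : 0 ≤ D)
    (hσup : ∀ x, σ x ≤ C₁ * Real.exp (-N x)) (hσA : ∀ x ∈ A, c₁ ≤ σ x) (hM0 : ∀ x, 0 ≤ M x) {k : ℕ} (hM : ∀ x, M x ≤ D * (N x + 1) ^ k) :
    ∫ x, F x * (σ x * M x) ∂μ ≤ 5 * Real.exp 1 * 2 ^ k * 4 ^ m * k.factorial * m.factorial * C₁ * D * V / (c₁ * v) * ∫ x, F x * σ x ∂μ := by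
  have hFi : Integrable F μ := Integrable.mono' (integrable_const CF) hFm.aestronglyMeasurable (ae_of_all _ fun x => by
    rw [Real.norm_eq_abs, abs_of_nonneg (hF0 x)]; exact hFb x)
  set μF : Measure X := μ.withDensity (fun x => ENNReal.ofReal (F x)) with hμF
  haveI : IsFiniteMeasure μF := by rw [hμF]; exact isFiniteMeasure_withDensity_ofReal hFi.hasFiniteIntegral
  have hV' : ∀ t : ℝ, 0 ≤ t → μF.real {x | N x ≤ t} ≤ V * (t + 1) ^ m := fun t ht => by
    rw [hμF, withDensity_ofReal_real_apply μ hFi hF0 (S := {x | N x ≤ t}) (hNm measurableSet_Iic)]; exact hV t ht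
  have hv' : v ≤ μF.real A := by rw [hμF, withDensity_ofReal_real_apply μ hFi hF0 hA]; exact hv
  have h := moment_ratio_le_of_volume_growth_floorSet μF hNm hN0 hV' hv0 hv' hσm hMm hσ0 hC₁ hc₁ hD hσup hσA hM0 hM
  rw [hμF, integral_withDensity_ofReal_eq μ hFm hF0, integral_withDensity_ofReal_eq μ hFm hF0] at h
  exact h

/-- ★ **WEIGHTED TAIL ABOVE A LEVEL**: with the `F`-weighted volume growth `∫_{N≤t}F ≤ V(t+1)^m` and `0 ≤ σ ≤ C₁e^{−N}`:
`∫_{T<N} F·σ dμ ≤ C₁·e^{−T/2}·5e^{1/2}·4^m·m!·V` — the Gaussian tail of the product density `F·σ` (appended 2026-08-29). [folklore] -/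
theorem setIntegral_weighted_tail_le (μ : Measure X) [IsFiniteMeasure μ] {F : X → ℝ} (hFm : Measurable F) (hF0 : ∀ x, 0 ≤ F x) {CF : ℝ} (hFb : ∀ x, F x ≤ CF)
    {N : X → ℝ} (hNm : Measurable N) (hN0 : ∀ x, 0 ≤ N x) {V : ℝ} {m : ℕ} (hV : ∀ t : ℝ, 0 ≤ t → ∫ x in {x | N x ≤ t}, F x ∂μ ≤ V * (t + 1) ^ m)
    {σ : X → ℝ} (hσm : Measurable σ) (hσ0 : ∀ x, 0 ≤ σ x) {C₁ : ℝ} (hC₁ : 0 ≤ C₁) (hσup : ∀ x, σ x ≤ C₁ * Real.exp (-N x)) (T : ℝ) :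
    ∫ x in {x | T < N x}, F x * σ x ∂μ ≤ C₁ * (Real.exp (-(T / 2)) * (5 * Real.exp (1 / 2) * 4 ^ m * m.factorial * V)) := by
  have hFi : Integrable F μ := Integrable.mono' (integrable_const CF) hFm.aestronglyMeasurable (ae_of_all _ fun x => by
    rw [Real.norm_eq_abs, abs_of_nonneg (hF0 x)]; exact hFb x)
  set μF : Measure X := μ.withDensity (fun x => ENNReal.ofReal (F x)) with hμF
  haveI : IsFiniteMeasure μF := by rw [hμF]; exact isFiniteMeasure_withDensity_ofReal hFi.hasFiniteIntegral
  have hV' : ∀ t : ℝ, 0 ≤ t → μF.real {x | N x ≤ t} ≤ V * (t + 1) ^ m := fun t ht => by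
    rw [hμF, withDensity_ofReal_real_apply μ hFi hF0 (S := {x | N x ≤ t}) (hNm measurableSet_Iic)]; exact hV t ht
  have hT : MeasurableSet {x | T < N x} := hNm measurableSet_Ioi
  have htail := setIntegral_exp_neg_le_of_volume_growth μF hNm hN0 hV' T
  -- `∫_{T<N} σ dμF ≤ C₁ ∫_{T<N} e^{-N} dμF`
  have hexpint : Integrable (fun x => Real.exp (-N x)) μF :=
    Integrable.mono' (integrable_const (1 : ℝ)) ((Real.measurable_exp.comp hNm.neg).aestronglyMeasurable)
      (ae_of_all _ fun x => by
        rw [Real.norm_eq_abs, abs_of_pos (Real.exp_pos _)]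
        exact Real.exp_le_one_iff.mpr (by linarith [hN0 x]))
  have hσint : Integrable σ μF :=
    Integrable.mono' (hexpint.const_mul C₁) hσm.aestronglyMeasurable (ae_of_all _ fun x => by rw [Real.norm_eq_abs, abs_of_nonneg (hσ0 x)]; exact hσup x)
  have h1 : ∫ x in {x | T < N x}, σ x ∂μF ≤ C₁ * ∫ x in {x | T < N x}, Real.exp (-N x) ∂μF := by
    rw [← integral_const_mul]
    exact setIntegral_mono_on hσint.integrableOn (hexpint.const_mul C₁).integrableOn hT fun x _ => hσup x
  -- translate the set integrals back to `μ`
  have e1 : ∫ x in {x | T < N x}, σ x ∂μF = ∫ x in {x | T < N x}, F x * σ x ∂μ := by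
    rw [hμF, ← integral_indicator hT, integral_withDensity_ofReal_eq μ hFm hF0, ← integral_indicator hT]
    refine integral_congr_ae (ae_of_all _ fun x => ?_)
    dsimp only
    by_cases hx : x ∈ {x | T < N x}
    · rw [Set.indicator_of_mem hx, Set.indicator_of_mem hx]
    · rw [Set.indicator_of_notMem hx, Set.indicator_of_notMem hx, mul_zero]
  rw [← e1]
  calc ∫ x in {x | T < N x}, σ x ∂μF ≤ C₁ * ∫ x in {x | T < N x}, Real.exp (-N x) ∂μF := h1
    _ ≤ C₁ * (Real.exp (-(T / 2)) * (5 * Real.exp (1 / 2) * 4 ^ m * m.factorial * V)) := mul_le_mul_of_nonneg_left htail hC₁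

end Summit.QuantumFields.YangMills.Theorems.FemtoTransferGap.RateTube

end
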